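import Summits.QuantumFields.YangMills.Theorems.IR.SCFloorSliceSums
import Summits.QuantumFields.YangMills.Theorems.IR.SCFloorSliceSpecies
import Summits.QuantumFields.YangMills.Theorems.IR.SCFloorFacingPlaquetteRep
import Summits.QuantumFields.YangMills.Theorems.SoloBlindSpacingPinning

/-!
# R2 of line `momentum-pincer`: `NoLightMoversSCTransfer` — the transfer `p⃗ = 0 ⇒ point` at strong coupling

Pooled prover `ym-ir-line-bsf-p1` (crux `IR`, stmt-QuantumFields-19354; rung plan `Cruxes/IR/Lines/momentum-pincer-rungs.md`
R2), first CONSUMER of the engine `FacingPlaquetteCovFloor` (parts 1–20).  VERBATIM the body of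
`Summit.QuantumFields.YangMills.Cruxes.IR.MomentumPincer.NoLightMoversSCTransfer` with `sliceSumCorr`, `spatialVec` written
out (`noLightMoversSCTransfer_holds`): on a strong-coupling window `[β₁, β₀]`, zero-momentum (slice-summed) clustering of
every species pair at ANY valid rate `m(β)` transfers to point clustering at rate `θ · m(β)`.
MECHANISM (a RATE CEILING from reflection positivity): for the plaquette `P` the slice sum `s_S(t)` is non-negative and
multiplicatively convex on the odd torus (part 20, tree `SoloBlind` RP), with `s_S(1) ≥ κ β⁴ ≥ κ β₁⁴` (part 19: the
diagonal `β⁴` law of the engine minus `O(β⁵)` off-diagonal terms) and `s_S(0) ≤ V` (part 19); the tree's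
`mulConvex_ratio_floor` / `mulConvex_lower_envelope` give `s_S(t) ≥ q^{t-1} κ β⁴`, `q = min(κβ₁⁴/V, ½)`, for `t ≤ S`; the
hypothesis for the pair `(P, P)` then forces `m(β) ≤ M := log(1/q)` (`rate_le_of_eventually_exp_le`); the conclusion is
R1's β-uniform point clustering at rate `c` (`MomentumPincerRung.noLightMoversSC_holds`) with `θ := c / M`.
HONEST: strong coupling only, group-blind plumbing; exercises the logic of Z2 where the dispersion is computable; it does
NOT prove `NoLightMovers`/`ZeroMomentumClustering` at weak coupling, `BalabanLadder.IR`, or the Clay Yang–Mills gap.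
-/

set_option autoImplicit false

noncomputable section

open MeasureTheory Filter Topology Function Finset
open Literature.MathematicalPhysics.QuantumFieldTheory
open Literature.MathematicalPhysics.QuantumLattice (plaquetteObs torusLift toTorusObservable configShift configShift_apply
  LGConfig IsSimpleCompactGroup)
open Summit.QuantumFields.YangMills.Theorems.SoloBlind (mulConvex_ratio_floor mulConvex_lower_envelope
  rate_le_of_eventually_exp_le)

namespace Summit.QuantumFields.YangMills.Cruxes.IR.SCFloor

/-- A geometric lower bound with ratio `q ∈ (0, 1)` against the hypothesis' exponential upper bound forces the rate
ceiling `m ≤ log (1/q)`. -/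
theorem rate_ceiling {q η C m : ℝ} (hq : 0 < q) (hη : 0 < η) {n₀ : ℕ}
    (h : ∀ n : ℕ, n₀ ≤ n → η * q ^ n ≤ C * Real.exp (-(m * n))) : m ≤ Real.log (1 / q) := by
  refine rate_le_of_eventually_exp_le (η := η) (C := C) hη ?_
  filter_upwards [eventually_ge_atTop n₀] with n hn
  have hqn : Real.exp (-(Real.log (1 / q) * n)) = q ^ n := by
    rw [one_div, Real.log_inv, neg_mul, neg_neg, mul_comm, Real.exp_nat_mul, Real.exp_log hq]
  rw [hqn]
  exact h n hn

/-- **R2 — `NoLightMoversSCTransfer` (PROVED).**  VERBATIM the body of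
`Summit.QuantumFields.YangMills.Cruxes.IR.MomentumPincer.NoLightMoversSCTransfer` (with `sliceSumCorr r.ρ β S A.F B.F t`
and `spatialVec` unfolded to their defining expressions): on a strong-coupling window `[β₁, β₀]`, slice-summed clustering at
any valid rate `m(β)` transfers to point clustering at rate `θ · m(β)`. -/
theorem noLightMoversSCTransfer_holds :
    ∀ (G : Type) [Group G] [TopologicalSpace G] [IsTopologicalGroup G] [CompactSpace G],
      IsCompactSimpleLieGroup G → letI : MeasurableSpace G := borel G; haveI : BorelSpace G := ⟨rfl⟩;
      ∀ r : LatticeRep G, ∃ β₁ β₀ θ : ℝ, 0 < β₁ ∧ β₁ < β₀ ∧ 0 < θ ∧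
        ∀ (m : ℝ → ℝ) (S₁ : ℝ → ℕ), (∀ β, 0 < m β) →
          (∀ A B : YMSpecies G, ∃ C : ℝ, ∀ β : ℝ, β₁ ≤ β → β ≤ β₀ → ∀ S t : ℕ, S₁ β ≤ S → t ≤ S →
              |∑ x : Fin 3 → ZMod (2 * S + 1), latticeConnectedCorr r.ρ β (2 * S + 1)
                  (fun U => A.F (configShift (fun i : Fin 4 => if h : i = 0 then (0 : ℤ) else
                    ((x (i.pred h)).valMinAbs : ℤ)) U)) B.F t| ≤ C * Real.exp (-(m β * t))) →
          ∃ S₃ : ℝ → ℕ, ∀ A B : YMSpecies G, ∃ C : ℝ, ∀ β : ℝ, β₁ ≤ β → β ≤ β₀ → ∀ S t : ℕ, S₃ β ≤ S → t ≤ S →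
              |latticeConnectedCorr r.ρ β (2 * S + 1) A.F B.F t| ≤ C * Real.exp (-(θ * m β * t)) := by
  intro G _ _ _ _ hG
  letI : MeasurableSpace G := borel G
  haveI : BorelSpace G := ⟨rfl⟩
  intro r
  have hemb : IsClosedEmbedding r.ρ := r.continuous.isClosedEmbedding r.injective
  haveI : T2Space G := hemb.isEmbedding.t2Space
  haveI : SecondCountableTopology G := hemb.isEmbedding.secondCountableTopology
  have hρ : Continuous r.ρ := r.continuous
  have hnc := latticeRep_re_trace_nonconst hG.1.2.1 r
  -- constants: R1's window/rate, the floor at time one, the ceiling at time zero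
  obtain ⟨βR, cR, hβR, hcR, hR1⟩ := MomentumPincerRung.noLightMoversSC_holds G hG r
  obtain ⟨βf, κ, hβf, hκ, hfloor⟩ := sliceSum_one_floor r.ρ hρ hnc
  obtain ⟨βz, V, hβz, hV, hzero⟩ := abs_sliceSum_zero_le r.ρ hρ
  set β₀ : ℝ := min βR (min βf βz) with hβ₀
  have hβ₀pos : 0 < β₀ := by rw [hβ₀]; exact lt_min hβR (lt_min hβf hβz)
  have hβ₀R : β₀ ≤ βR := min_le_left _ _
  have hβ₀f : β₀ ≤ βf := (min_le_right _ _).trans (min_le_left _ _)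
  have hβ₀z : β₀ ≤ βz := (min_le_right _ _).trans (min_le_right _ _)
  set β₁ : ℝ := β₀ / 2 with hβ₁
  have hβ₁pos : 0 < β₁ := by rw [hβ₁]; exact half_pos hβ₀pos
  have hfl0 : 0 < κ * β₁ ^ 4 / V := div_pos (mul_pos hκ (pow_pos hβ₁pos 4)) hV
  set q : ℝ := min (κ * β₁ ^ 4 / V) (1 / 2) with hq
  have hqpos : 0 < q := by rw [hq]; exact lt_min hfl0 (by norm_num)
  have hqhalf : q ≤ 1 / 2 := min_le_right _ _
  set M : ℝ := Real.log (1 / q) with hM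
  have hMpos : 0 < M := by
    rw [hM]; exact Real.log_pos (by rw [lt_div_iff₀ hqpos]; linarith)
  have hθpos : 0 < cR / M := div_pos hcR hMpos
  refine ⟨β₁, β₀, cR / M, hβ₁pos, by rw [hβ₁]; linarith, hθpos, ?_⟩
  intro m S₁ _ hHyp
  refine ⟨fun _ => 0, fun A B => ?_⟩
  obtain ⟨C, hC⟩ := hR1 A B
  refine ⟨C, fun β hβ1 hβ0 S t _ htS => ?_⟩
  have hβpos : 0 < β := lt_of_lt_of_le hβ₁pos hβ1
  ---------------------------------------------------------------- the rate ceiling `m β ≤ M`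
  have hceil : m β ≤ M := by
    obtain ⟨Psp, hPF⟩ := exists_plaquetteSpecies r.ρ hρ
    obtain ⟨CP, hP⟩ := hHyp Psp Psp
    rw [hPF] at hP
    -- the lower envelope on every torus `S' ≥ 1`: `q^{t-1} κ β⁴ ≤ s_{S'}(t)` for `1 ≤ t ≤ 2S'+1`
    have henv : ∀ S' : ℕ, 1 ≤ S' → ∀ n : ℕ, 1 ≤ n → n ≤ 2 * S' + 1 →
        q ^ (n - 1) * (κ * β ^ 4) ≤ ∑ xs : Fin 3 → ZMod (2 * S' + 1), latticeConnectedCorr r.ρ β (2 * S' + 1)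
          (fun U => plaquetteObs r.ρ (0 : Literature.Probability.LatticeModels.Site 4) 1 2
            (configShift (fun i : Fin 4 => if h : i = 0 then (0 : ℤ) else ((xs (i.pred h)).valMinAbs : ℤ)) U))
          (plaquetteObs r.ρ (0 : Literature.Probability.LatticeModels.Site 4) 1 2) n := by
      intro S' hS' n hn1 hnK
      set a : ℕ → ℝ := fun n => ∑ xs : Fin 3 → ZMod (2 * S' + 1), latticeConnectedCorr r.ρ β (2 * S' + 1)
          (fun U => plaquetteObs r.ρ (0 : Literature.Probability.LatticeModels.Site 4) 1 2
            (configShift (fun i : Fin 4 => if h : i = 0 then (0 : ℤ) else ((xs (i.pred h)).valMinAbs : ℤ)) U))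
          (plaquetteObs r.ρ (0 : Literature.Probability.LatticeModels.Site 4) 1 2) n with ha
      have h0 : ∀ k, k ≤ 2 * S' + 1 → 0 ≤ a k := fun k _ => sliceSum_nonneg r.ρ hρ hβpos.le hS' k
      have hconv : ∀ k, k + 2 ≤ 2 * S' + 1 → a (k + 1) ^ 2 ≤ a k * a (k + 2) := fun k hk =>
        sliceSum_logConvex r.ρ hρ hβpos.le hS' k hk
      have ha1 : κ * β ^ 4 ≤ a 1 := hfloor S' hS' β hβpos (hβ0.trans hβ₀f)
      have ha0 : a 0 ≤ V := (le_abs_self _).trans (hzero S' hS' β hβpos.le (hβ0.trans hβ₀z))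
      have hβ1' : κ * β₁ ^ 4 ≤ κ * β ^ 4 :=
        mul_le_mul_of_nonneg_left (pow_le_pow_left₀ hβ₁pos.le hβ1 4) hκ.le
      have hfl : q ^ (1 - 0) * a 0 ≤ a 1 := by
        rw [Nat.sub_zero, pow_one]
        have h1 : q * a 0 ≤ (κ * β₁ ^ 4 / V) * V :=
          mul_le_mul (min_le_left _ _) ha0 (h0 0 (Nat.zero_le _)) hfl0.le
        rw [div_mul_cancel₀ _ hV.ne'] at h1
        linarith
      have hstep := mulConvex_ratio_floor h0 hconv hqpos (n₁ := 0) (n₂ := 1) zero_lt_one hfl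
      have hlow := mulConvex_lower_envelope hqpos.le hstep n hn1 hnK
      exact (mul_le_mul_of_nonneg_left ha1 (pow_nonneg hqpos.le _)).trans hlow
    -- against the hypothesis for the pair `(P, P)` at `S = t = n`
    refine rate_ceiling hqpos (η := κ * β ^ 4 / q) (C := CP) (div_pos (mul_pos hκ (pow_pos hβpos 4)) hqpos)
      (n₀ := max (S₁ β) 1) fun n hn => ?_
    have hn1 : 1 ≤ n := le_of_max_le_right hn
    have hnS : S₁ β ≤ n := le_of_max_le_left hn
    have h1 := henv n hn1 n hn1 (by omega)
    have h2 := hP β hβ1 hβ0 n n hnS le_rfl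
    have h3 := (le_abs_self _).trans h2
    obtain ⟨k, rfl⟩ : ∃ k, n = k + 1 := ⟨n - 1, by omega⟩
    have hqn : κ * β ^ 4 / q * q ^ (k + 1) = q ^ (k + 1 - 1) * (κ * β ^ 4) := by
      rw [Nat.add_sub_cancel, pow_succ q k, mul_comm (q ^ k) q, ← mul_assoc, div_mul_cancel₀ _ hqpos.ne']
      ring
    rw [hqn]
    exact h1.trans h3
  ---------------------------------------------------------------- conclusion from R1
  have hpt := hC β hβpos (hβ0.trans hβ₀R) S t htS
  have hC0 : 0 ≤ C := (mul_nonneg_iff_of_pos_right (Real.exp_pos _)).1 ((abs_nonneg _).trans hpt)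
  refine hpt.trans (mul_le_mul_of_nonneg_left (Real.exp_le_exp.2 ?_) hC0)
  have ht0 : (0 : ℝ) ≤ t := Nat.cast_nonneg _
  have hθm : cR / M * m β ≤ cR := by
    rw [div_mul_eq_mul_div, div_le_iff₀ hMpos]
    exact mul_le_mul_of_nonneg_left hceil hcR.le
  have h := mul_le_mul_of_nonneg_right hθm ht0
  linarith

end Summit.QuantumFields.YangMills.Cruxes.IR.SCFloor

end
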